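import Summits.Ventures.LatticeQCDFlow.Exactness.FlowSamplerAutocorrelation
import Summits.Ventures.LatticeQCDFlow.Exactness.IMHAutocovLayerCake
import HarnessLib

/-!
# What the Kish fraction `κ = Z²/W₂` does and does not certify: it prices the reweighting estimate
# of `Z` (which the exact chain cannot see at all), but `Var/(N·ESS)` mis-states the reweighting
# error of an observable by an unbounded factor in EITHER direction — already on two states

HONEST FRAMING: exact (Metropolis-corrected) sampling algorithms for lattice gauge theory;
figures of merit are autocorrelation/cost numbers at stated couplings and volumes; no
continuum-physics claim.  (SCALAR calibration rung S0-A: not a gauge result.)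

Venture `LatticeQCDFlow` (cell pub-lqcd), topic `Exactness`; FANOUT row 2 (`s0-phi4`, FLOW arm
`imhOp μ w q̃`).  NEW WORK of the cell (elementary; nothing is cited as a fact; no definition),
third file of the session's 'REWEIGHT OR ACCEPT/REJECT?' group (`FlowSamplerVsReweighting`,
`FlowSamplerVsReweightingWitness`, `Phi4FlowReweightingCLT`).  The cell's fitness uses
ESS-per-cost with `ESS/N = κ = Z²/W₂` (`W₂ = ∫ b w`, `b = w/q̃`) next to `τ_int`-per-cost.  Two
hygiene statements about the scope of `κ`:

(1) **`κ` prices the partition function, the chain forgets it.**  The mean weight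
`Ẑ_N = N⁻¹ Σ b(φᵢ)` of `N` independent flow draws is unbiased for `Z = ∫ w` with one-draw relative
variance `Var_q(b)/Z² = W₂/Z² − 1 = 1/κ − 1` (`weight_mean_eq`, `weight_relVariance_eq`); the exact
chain's one-step operator is INVARIANT under `w ↦ c·w` (`imhAcceptQ_const_mul_weight`,
`imhOp_const_mul_weight`; lattice: `imhOp_const_mul_gibbsWeight`) — every functional of the exact
chain's path law is blind to `Z` (and to an additive constant in the action), so free energies come
from the weights, never from the accept/reject stream.

(2) **`κ` is observable-blind.**  With `σ²_RW(g) = E_π[(b/Z) g²]` the reweighting CLT variance of a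
centred `g` (row 4's `SelfNormalisedReweightingCLT`, row 2's `Phi4FlowReweightingCLT`) and
`Var_π(g)/κ` the "`Var/ESS`" shortcut, the ratio `σ²_RW(g)·κ/Var_π(g)` is unbounded above AND its
inverse is unbounded, on the two-point space already: target `(p, 1 − p)`, model `(s, 1 − s)`,
`g = (1 − p, −p)` the centred indicator of state `0` (counting measure; namespace `KishScopeWitness`):
`σ²_RW = p²(1 − p)²/(s(1 − s))`, `Var_π = p(1 − p)`, `1/κ = p²/s + (1 − p)²/(1 − s)`, so
`σ²_RW·κ/Var = p(1 − p)/((1 − s)p² + s(1 − p)²)`; at `s = p²` (flow UNDER-covers the rare state)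
the ratio is `1/(2p) → ∞`, at `s = 1 − p²` (flow OVER-covers it) it is `≤ 2p → 0` (`p ≤ ¼`, `p → 0`).

## What is proved

* general space (`w, q > 0`, `∫ q = 1`): `weight_mean_eq` (`∫ b q = Z`), `weight_sqMean_eq`
  (`∫ b² q = W₂`), **`weight_relVariance_eq`** (`(∫ (b − Z)² q)/Z² = W₂/Z² − 1`);
  **`imhAcceptQ_const_mul_weight`**, **`imhOp_const_mul_weight`** (`c > 0`);
  lattice: **`imhOp_const_mul_gibbsWeight`** (`imhOp vol (c·e^{−S}) q̃ = imhOpPhi4 J λ q̃`);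
* two states (`Var_π(g) = p(1 − p)` is `ReweightingWitness.sqNorm_g` of the sibling witness file, re-derived inline): `reweightVar_eq`, `invKish_eq`, **`ratio_eq`**
  (`σ²_RW·κ/Var = p(1 − p)/((1 − s)p² + s(1 − p)²)`), **`ratio_at_under`** (`s = p²`: `= 1/(2p)`),
  **`ratio_at_over`** (`s = 1 − p²`, `p ≤ ¼`: `≤ 2p`), **`essShortcut_understates_unboundedly`**
  (∀ `C` ∃ `p, s`: `σ²_RW > C · Var/κ`), **`essShortcut_overstates_unboundedly`**
  (∀ `C > 0` ∃ `p, s`: `Var/κ > C · σ²_RW`).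

Reading for S0-A (no numerics implied): report `κ` for what it certifies — the relative error of
`Ẑ` (free-energy differences) and, for SIGN / weight-blind observables, `τ_int` itself (tree:
`IMHSignObservableSandwich`, row 3's `IMHWeightBlindTauESS`) — and report per-observable reweighting
error bars from `σ²_RW(f)`, never from `Var/ESS`.  NOT CLAIMED: any value for any network or run;
that either regime is typical of trained flows; finite-`N` bias; anything for the HMC / local arms.
-/

namespace Summit.Ventures.LatticeQCDFlow.Exactness

open Real MeasureTheory Filter Finset Set Topology
open Summit.Ventures.LatticeQCDFlow.Scoring

/-! ## §1 General space: the weights see `Z`, the chain does not -/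

section General

variable {X : Type*} [MeasurableSpace X] {μ : Measure X} {w q : X → ℝ}

omit [MeasurableSpace X] in
/-- `b q = w` pointwise (`q > 0`). -/
theorem weight_mul_model (hq0 : ∀ t, 0 < q t) (t : X) : w t / q t * q t = w t := by
  rw [div_mul_cancel₀ _ (hq0 t).ne']

/-- **`E_q[b] = Z`**: the mean importance weight of one flow draw is the partition function. -/
theorem weight_mean_eq (hq0 : ∀ t, 0 < q t) :
    ∫ t, w t / q t * q t ∂μ = ∫ t, w t ∂μ :=
  integral_congr_ae (Eventually.of_forall fun t => weight_mul_model hq0 t)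

/-- **`E_q[b²] = W₂ = ∫ b w`**. -/
theorem weight_sqMean_eq (hq0 : ∀ t, 0 < q t) :
    ∫ t, (w t / q t) ^ 2 * q t ∂μ = ∫ t, w t / q t * w t ∂μ :=
  integral_congr_ae (Eventually.of_forall fun t => by
    have hq := (hq0 t).ne'
    field_simp)

/-- **`Var_q(b)/Z² = W₂/Z² − 1 = 1/κ − 1`**: the one-draw relative variance of the unbiased
partition-function estimate `Ẑ_N = N⁻¹ Σ b(φᵢ)` (so `N · relVar(Ẑ_N) = 1/κ − 1`), for `w, q > 0`
integrable with `∫ q = 1` and `W₂ < ∞`. -/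
theorem weight_relVariance_eq (hw0 : ∀ t, 0 < w t) (hwi : Integrable w μ) (hq0 : ∀ t, 0 < q t)
    (hqi : Integrable q μ) (hq1 : ∫ t, q t ∂μ = 1)
    (hW₂ : Integrable (fun t => w t / q t * w t) μ) :
    (∫ t, (w t / q t - ∫ z, w z ∂μ) ^ 2 * q t ∂μ) / (∫ z, w z ∂μ) ^ 2
      = (∫ t, w t / q t * w t ∂μ) / (∫ z, w z ∂μ) ^ 2 - 1 := by
  set Z : ℝ := ∫ z, w z ∂μ with hZdef
  have hZ : 0 < Z := integral_pos_of_pos hw0 hwi hq1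
  have hbw : Integrable (fun t => w t / q t * q t) μ :=
    hwi.congr (Eventually.of_forall fun t => (weight_mul_model hq0 t).symm)
  have e : (fun t => (w t / q t - Z) ^ 2 * q t)
      = fun t => w t / q t * w t - 2 * Z * (w t / q t * q t) + Z ^ 2 * q t := by
    funext t
    have hq := (hq0 t).ne'
    field_simp
    ring
  rw [e, integral_add (hW₂.sub' (hbw.const_mul (2 * Z))) (hqi.const_mul (Z ^ 2)),
    integral_sub hW₂ (hbw.const_mul (2 * Z)), integral_const_mul, integral_const_mul,
    weight_mean_eq hq0, hq1, ← hZdef]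
  have hZ0 : Z ≠ 0 := hZ.ne'
  field_simp
  ring

omit [MeasurableSpace X] in
/-- **THE ACCEPTANCE IS BLIND TO `Z`**: `α_{c·w} = α_w` for every `c > 0`. -/
theorem imhAcceptQ_const_mul_weight {c : ℝ} (hc : 0 < c) (t t' : X) :
    imhAcceptQ (fun s => c * w s) q t t' = imhAcceptQ w q t t' := by
  unfold imhAcceptQ
  congr 1
  rw [mul_assoc, mul_assoc, mul_div_mul_left _ _ hc.ne']

/-- **THE EXACT SAMPLER IS BLIND TO `Z`**: `imhOp μ (c·w) q = imhOp μ w q` for every `c > 0` — no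
functional of the chain's transition law (hence of its path law from a `Z`-free start) determines the
partition function; an additive constant in the action changes nothing. -/
theorem imhOp_const_mul_weight {c : ℝ} (hc : 0 < c) :
    imhOp μ (fun s => c * w s) q = imhOp μ w q := by
  funext g t
  unfold imhOp
  simp_rw [imhAcceptQ_const_mul_weight hc]

end General

/-! ## §2 Lattice: the flow sampler of φ⁴ does not see a constant added to the action -/

section Lattice

variable {n : ℕ}

/-- **`imhOp vol (c·e^{−S}) q̃ = imhOpPhi4 J λ q̃`** (`c > 0`): shifting the action by a constant
(`e^{−(S + s)} = e^{−s} e^{−S}`) leaves row 2's exact flow sampler unchanged — the accept/reject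
stream carries no information on `Z = ∫ e^{−S}`; the weights `b = e^{−S}/q̃` do (`weight_mean_eq`). -/
theorem imhOp_const_mul_gibbsWeight (J : Fin (n + 1) → Fin (n + 1) → ℝ) (lam : ℝ)
    (q : (Fin (n + 1) → ℝ) → ℝ) {c : ℝ} (hc : 0 < c) :
    imhOp volume (fun φ => c * gibbsWeight J lam φ) q = imhOpPhi4 J lam q := by
  rw [imhOp_const_mul_weight hc, imhOpPhi4_eq_imhOp]

end Lattice

/-! ## §3 Two states: `Var/ESS` against the reweighting variance, both ways unbounded -/

namespace KishScopeWitness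

/-- `W₂ = 1/κ = p²/s + (1 − p)²/(1 − s)` for the model `(s, 1 − s)` (`Z = 1`). -/
theorem invKish_eq {p s : ℝ} (hs : 0 < s) (hs1 : s < 1) :
    ∫ t, (![p, 1 - p] : Fin 2 → ℝ) t / (![s, 1 - s] : Fin 2 → ℝ) t * (![p, 1 - p] : Fin 2 → ℝ) t
      ∂(Measure.count : Measure (Fin 2)) = p ^ 2 / s + (1 - p) ^ 2 / (1 - s) := by
  rw [integral_count]
  simp [Fin.sum_univ_two]
  have h1 : s ≠ 0 := hs.ne'
  have h2 : 1 - s ≠ 0 := by linarith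
  field_simp

/-- `σ²_RW(g) = ∫ g² b w = p²(1 − p)²/(s(1 − s))` (`Z = 1`). -/
theorem reweightVar_eq {p s : ℝ} (hs : 0 < s) (hs1 : s < 1) :
    ∫ t, (![1 - p, -p] : Fin 2 → ℝ) t ^ 2
        * ((![p, 1 - p] : Fin 2 → ℝ) t / (![s, 1 - s] : Fin 2 → ℝ) t * (![p, 1 - p] : Fin 2 → ℝ) t)
      ∂(Measure.count : Measure (Fin 2)) = p ^ 2 * (1 - p) ^ 2 / (s * (1 - s)) := by
  rw [integral_count]
  simp [Fin.sum_univ_two]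
  have h1 : s ≠ 0 := hs.ne'
  have h2 : 1 - s ≠ 0 := by linarith
  field_simp
  ring

/-- **`σ²_RW·κ/Var = p(1 − p)/((1 − s)p² + s(1 − p)²)`** — the reweighting variance of `g` over the
`Var/ESS` shortcut, in closed form (`0 < p < 1`, `0 < s < 1`). -/
theorem ratio_eq {p s : ℝ} (hp : 0 < p) (hp1 : p < 1) (hs : 0 < s) (hs1 : s < 1) :
    (p ^ 2 * (1 - p) ^ 2 / (s * (1 - s))) / ((p * (1 - p)) * (p ^ 2 / s + (1 - p) ^ 2 / (1 - s)))
      = p * (1 - p) / ((1 - s) * p ^ 2 + s * (1 - p) ^ 2) := by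
  have h1 : s ≠ 0 := hs.ne'
  have h2 : 1 - s ≠ 0 := by linarith
  have h3 : p ≠ 0 := hp.ne'
  have h4 : 1 - p ≠ 0 := by linarith
  field_simp

/-- **UNDER-COVERED RARE STATE (`s = p²`): the ratio is `1/(2p)`** — `Var/ESS` understates the
reweighting error by the factor `2p`. -/
theorem ratio_at_under {p : ℝ} (hp : 0 < p) (hp1 : p < 1) :
    p * (1 - p) / ((1 - p ^ 2) * p ^ 2 + p ^ 2 * (1 - p) ^ 2) = 1 / (2 * p) := by
  have h3 : p ≠ 0 := hp.ne'
  have h4 : 1 - p ≠ 0 := by linarith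
  have e : (1 - p ^ 2) * p ^ 2 + p ^ 2 * (1 - p) ^ 2 = 2 * p ^ 2 * (1 - p) := by ring
  rw [e, div_eq_div_iff (by positivity) (by positivity)]
  ring

/-- **OVER-COVERED RARE STATE (`s = 1 − p²`): the ratio is `≤ 2p`** (`p ≤ ¼`) — `Var/ESS` overstates
the reweighting error by at least the factor `1/(2p)`. -/
theorem ratio_at_over {p : ℝ} (hp : 0 < p) (hp1 : p ≤ 1 / 4) :
    p * (1 - p) / ((1 - (1 - p ^ 2)) * p ^ 2 + (1 - p ^ 2) * (1 - p) ^ 2) ≤ 2 * p := by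
  have hA : 15 / 16 ≤ 1 - p ^ 2 := by nlinarith
  have hB : 9 / 16 ≤ (1 - p) ^ 2 := by nlinarith
  have hkey : 1 / 2 ≤ (1 - p ^ 2) * (1 - p) ^ 2 := by nlinarith
  have hden : 0 < (1 - (1 - p ^ 2)) * p ^ 2 + (1 - p ^ 2) * (1 - p) ^ 2 := by
    have h1 : 0 ≤ (1 - (1 - p ^ 2)) * p ^ 2 := by nlinarith [sq_nonneg p]
    linarith
  rw [div_le_iff₀ hden]
  nlinarith [mul_le_mul_of_nonneg_left hkey hp.le, sq_nonneg p, mul_pos hp hp]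

/-- **`Var/ESS` UNDERSTATES UNBOUNDEDLY**: for every `C` there are `p, s ∈ (0, 1)` with
`σ²_RW(g) > C · Var_π(g)/κ` (the two-state data above, `Z = 1`). -/
theorem essShortcut_understates_unboundedly (C : ℝ) :
    ∃ p s : ℝ, 0 < p ∧ p < 1 ∧ 0 < s ∧ s < 1 ∧
      C * ((∫ t, (![1 - p, -p] : Fin 2 → ℝ) t ^ 2 * (![p, 1 - p] : Fin 2 → ℝ) t
              ∂(Measure.count : Measure (Fin 2)))
            * ∫ t, (![p, 1 - p] : Fin 2 → ℝ) t / (![s, 1 - s] : Fin 2 → ℝ) t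
                * (![p, 1 - p] : Fin 2 → ℝ) t ∂(Measure.count : Measure (Fin 2)))
        < ∫ t, (![1 - p, -p] : Fin 2 → ℝ) t ^ 2
            * ((![p, 1 - p] : Fin 2 → ℝ) t / (![s, 1 - s] : Fin 2 → ℝ) t
              * (![p, 1 - p] : Fin 2 → ℝ) t) ∂(Measure.count : Measure (Fin 2)) := by
  -- `p = 1/(4(max C 1 + 1))`, `s = p²`: ratio `1/(2p) = 2(max C 1 + 1) > C`
  set M : ℝ := max C 1 with hM
  have hM1 : 1 ≤ M := le_max_right _ _
  have hMC : C ≤ M := le_max_left _ _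
  set p : ℝ := 1 / (4 * (M + 1)) with hpdef
  have hp : 0 < p := by positivity
  have hp1 : p < 1 := by
    rw [hpdef, div_lt_one (by positivity)]; linarith
  refine ⟨p, p ^ 2, hp, hp1, by positivity, by nlinarith, ?_⟩
  have hV : ∫ t, (![1 - p, -p] : Fin 2 → ℝ) t ^ 2 * (![p, 1 - p] : Fin 2 → ℝ) t
      ∂(Measure.count : Measure (Fin 2)) = p * (1 - p) := by
    rw [integral_count]; simp [Fin.sum_univ_two]; ring
  rw [hV, invKish_eq (by positivity) (by nlinarith), reweightVar_eq (by positivity) (by nlinarith)]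
  have h4 : 1 - p ≠ 0 := by linarith
  have h5 : 0 < 1 - p ^ 2 := by nlinarith
  have hp2 : 0 < 1 + p := by linarith
  have hfac : 1 - p ^ 2 = (1 - p) * (1 + p) := by ring
  have e1 : p ^ 2 * (1 - p) ^ 2 / (p ^ 2 * (1 - p ^ 2)) = (1 - p) / (1 + p) := by
    rw [hfac, div_eq_div_iff (by positivity) hp2.ne']
    ring
  have e2 : p * (1 - p) * (p ^ 2 / p ^ 2 + (1 - p) ^ 2 / (1 - p ^ 2))
      = 2 * p * (1 - p) / (1 + p) := by
    rw [hfac, div_self (by positivity), mul_div_assoc]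
    rw [show (1 - p) ^ 2 / ((1 - p) * (1 + p)) = (1 - p) / (1 + p) by
      rw [div_eq_div_iff (by positivity) hp2.ne']; ring]
    field_simp
    ring
  rw [e1, e2]
  rw [show C * (2 * p * (1 - p) / (1 + p)) = (C * (2 * p) * (1 - p)) / (1 + p) by ring,
    div_lt_div_iff_of_pos_right hp2]
  have hMp : M * (2 * p) = 1 / 2 * (M / (M + 1)) := by
    have hM1' : (M + 1) ≠ 0 := by positivity
    rw [hpdef]
    field_simp
    ring
  have hMM : M / (M + 1) < 1 := by rw [div_lt_one (by linarith)]; linarith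
  have hCp : C * (2 * p) ≤ 1 / 2 := by
    nlinarith [mul_le_mul_of_nonneg_right hMC (by positivity : (0:ℝ) ≤ 2 * p), hMp, hMM]
  have h1p : 0 < 1 - p := by linarith
  nlinarith [mul_pos h1p hp, hCp]

/-- **`Var/ESS` OVERSTATES UNBOUNDEDLY**: for every `C > 0` there are `p, s ∈ (0, 1)` with
`Var_π(g)/κ > C · σ²_RW(g)`. -/
theorem essShortcut_overstates_unboundedly {C : ℝ} (hC : 0 < C) :
    ∃ p s : ℝ, 0 < p ∧ p < 1 ∧ 0 < s ∧ s < 1 ∧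
      C * ∫ t, (![1 - p, -p] : Fin 2 → ℝ) t ^ 2
            * ((![p, 1 - p] : Fin 2 → ℝ) t / (![s, 1 - s] : Fin 2 → ℝ) t
              * (![p, 1 - p] : Fin 2 → ℝ) t) ∂(Measure.count : Measure (Fin 2))
        < (∫ t, (![1 - p, -p] : Fin 2 → ℝ) t ^ 2 * (![p, 1 - p] : Fin 2 → ℝ) t
              ∂(Measure.count : Measure (Fin 2)))
            * ∫ t, (![p, 1 - p] : Fin 2 → ℝ) t / (![s, 1 - s] : Fin 2 → ℝ) t
                * (![p, 1 - p] : Fin 2 → ℝ) t ∂(Measure.count : Measure (Fin 2)) := by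
  -- `p = min (1/4) (1/(4C))`, `s = 1 − p²`: `σ²_RW = p²(1−p)²/((1−p²)p²) = (1−p)/(1+p)`,
  -- `Var/κ = p(1−p)(p²/(1−p²) + (1−p)²/p²)` ≥ `(1−p)³/p` > `C (1−p)/(1+p)`
  set p : ℝ := min (1 / 4) (1 / (4 * C)) with hpdef
  have hp : 0 < p := lt_min (by norm_num) (by positivity)
  have hp4 : p ≤ 1 / 4 := min_le_left _ _
  have hpC : p ≤ 1 / (4 * C) := min_le_right _ _
  have hp1 : p < 1 := by linarith
  have hs : 0 < 1 - p ^ 2 := by nlinarith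
  have hs1 : 1 - p ^ 2 < 1 := by nlinarith
  refine ⟨p, 1 - p ^ 2, hp, hp1, hs, hs1, ?_⟩
  have hV : ∫ t, (![1 - p, -p] : Fin 2 → ℝ) t ^ 2 * (![p, 1 - p] : Fin 2 → ℝ) t
      ∂(Measure.count : Measure (Fin 2)) = p * (1 - p) := by
    rw [integral_count]; simp [Fin.sum_univ_two]; ring
  rw [hV, invKish_eq hs hs1, reweightVar_eq hs hs1]
  have e0 : 1 - (1 - p ^ 2) = p ^ 2 := by ring
  rw [e0]
  have h4 : 1 - p ≠ 0 := by linarith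
  have hfac : 1 - p ^ 2 = (1 - p) * (1 + p) := by ring
  have hp2 : 0 < 1 + p := by linarith
  have e1 : p ^ 2 * (1 - p) ^ 2 / ((1 - p ^ 2) * p ^ 2) = (1 - p) / (1 + p) := by
    rw [hfac, div_eq_div_iff (by positivity) hp2.ne']
    ring
  rw [e1]
  -- lower bound for the right side: keep only the second summand
  have hR : (1 - p) ^ 3 / p ≤ p * (1 - p) * (p ^ 2 / (1 - p ^ 2) + (1 - p) ^ 2 / p ^ 2) := by
    have h1 : 0 ≤ p * (1 - p) * (p ^ 2 / (1 - p ^ 2)) := by positivity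
    have h2 : p * (1 - p) * ((1 - p) ^ 2 / p ^ 2) = (1 - p) ^ 3 / p := by
      rw [mul_div_assoc', div_eq_div_iff (by positivity) hp.ne']
      ring
    nlinarith [h1, h2]
  refine lt_of_lt_of_le ?_ hR
  rw [show C * ((1 - p) / (1 + p)) = C * (1 - p) / (1 + p) by ring,
    div_lt_div_iff₀ hp2 hp]
  -- `C (1−p) p < (1−p)³ (1+p)`: `C p ≤ 1/4` and `(1−p)²(1+p) ≥ (3/4)²·1 > 1/4`
  have hCp : C * p ≤ 1 / 4 := by
    have h := mul_le_mul_of_nonneg_left hpC hC.le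
    have e : C * (1 / (4 * C)) = 1 / 4 := by
      rw [mul_one_div, div_eq_iff (by positivity)]
      ring
    linarith [h, e]
  have h1p : 0 < 1 - p := by linarith
  have h34 : 3 / 4 ≤ 1 - p := by linarith
  have hsq : 9 / 16 ≤ (1 - p) ^ 2 := by nlinarith
  nlinarith [mul_pos h1p hp, mul_pos (mul_pos h1p h1p) hp2, hCp, hp4,
    mul_le_mul_of_nonneg_left hsq hp2.le, mul_le_mul_of_nonneg_left hCp h1p.le]

end KishScopeWitness

end Summit.Ventures.LatticeQCDFlow.Exactness
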